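import Summits.QuantumFields.YangMills.Theorems.BalabanUVNodesN15KingModelTreeGraphKing
import Summits.QuantumFields.YangMills.Theorems.BalabanUVNodesN15KingModelGraphReplacementDressed
import Summits.QuantumFields.YangMills.Theorems.BalabanUVNodesN15KingModelGraphReplacementExtLines

/-!
# BalabanUVNodes ∕ N15 — THE KING-MODEL RUNG (PART Ι-e): PROPOSITION 3.6 FOR TREE GRAPHS **WITH DRESSED VERTICES**, BY NAME AT `A = 0` AND A CONSTANT
# BACKGROUND — complex one-vertex factors (the engine over `RCLike 𝕜`), the dressings (3.46) replaced via (3.72) BY NAME (the curved case adds `Θ_K` PER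
# VERTEX, first order in `η`) and the external lines (3.71) via Proposition 3.8 BY NAME (`C₃·L^{−γK}` per external line) (Track A, DAG node N15 = NE2; FAN-OUT v1.1 §N15 s3 «KING-MODEL RUNG … + the one-line statement of what
# the curved case adds»)

HONEST FRAMING.  Count-neutral (cell `pub-ymgap`, seat `pub-ymgap-dag-n15-e` g26; `--supports stmt-QuantumFields-27366 --as helper` = K3⁸
`SpineGivenEndpointR13SepCoPHV`).  TEMPLATE LITERATURE: C. King, *The U(1) Higgs model. I. The continuum limit*, Commun. Math. Phys. **102** (1986) 649–677
[King1986], Proposition 3.6 (3.56) p. 662, proof pp. 663–665; p. 665 [PDF 17] *«The operator (3.46) can be replaced using the following bound: (3.72)»*.  Part Ι-d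
(`…TreeGraphKing`) proved Prop. 3.6 for tree graphs with REAL one-vertex factors; the dressings (3.46) are unimodular COMPLEX phases (part Κ-b `kingDressing`),
so this file re-runs part Ι-d's assembly over `RCLike 𝕜` with EXPLICIT constants (the engine of parts Ι-a∕Ι-b is over `RCLike 𝕜` already; the real line kernels
are cast) and places on every vertex the dressing ((3.72) BY NAME: part Κ-b `ineq372Printed_king`, part Η-d's `kingDressTheta`) and an optional external line
((3.71) BY NAME: part Η-e `kingExt_rate_of_prop38`, `kingExt_sizes_unif`).  King's U(1)∕`A = 0` MODEL with a CONSTANT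
background `B` (p. 661 «Let B be the value of A_k at some point x₀ in □′»); NOT Bałaban's non-abelian `G(U)` of [B9]; NOT a node discharge; nothing continuum ∕ ℝ⁴ ∕
OS ∕ mass-gap ∕ Clay.  0 `sorry`; standard axioms.
WHAT THIS FILE PROVES.
* §1 (namespace `…Graph`) `STree.nverts`, `vsum_const` (`vsum c = c·nverts`), `vsum_add`; ★ `oneVertex_mul` — a PRODUCT of two one-vertex factors (sizes `p`, `q`,
  relative rates `s`, `t` through the pairing) is a one-vertex factor of size `p·q` and relative rate `s + t` (`f′g′ − fg = (f′ − f)g′ + f(g′ − g)`).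
* §2 (namespace `…Curved`) ★★ **`king_prop36_tree_of_constants`** — THE ASSEMBLY WITH EXPLICIT CONSTANTS over `RCLike 𝕜` (given `Prop37PrintedAt` for both runs
  and `Prop39PrintedAt` at `γ ≤ ½` — part Ω₂'s letters — for one mass∕volume∕`n`: `‖E^{(K+n)}(T) − E^{(K)}(T)‖ ≤ (Γ′ + Γ·(C₂·L^{−γK}·nlines T + vsum s T))·(C₁^{nlines T}·vprod q T)`,
  `C₁ = 2C·c368`, `C₂ = ((1−L^{−1∕2})^{−1}+2)∕2`); ★★ **`king_prop36_tree_zeroField_rclike`** (the ∃-packaging via Ω₂ at `α = ½`, `γ := min(γ_Ω₂, ½)`; part Ι-d's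
  `king_prop36_tree_zeroField` is the `𝕜 = ℝ` reading without casts).
* §3 defs `kingExtFac`∕`kingExtFac′` (the external-line factor at a vertex: `1` or `ℋ_K(x, y_b)`∕`∂ℋ_K`, part Η-e `kingExtLo`∕`kingExtHi`, in `ℂ`), `extSize` (`1` ∕ `a·c_e`),
  `extRate` (`0` ∕ `r`); ★★★ **`king_prop36_tree_full`** (`𝕜 = ℂ`): every vertex carries DRESSING (3.46) × optional EXTERNAL LINE (3.71) × abstract factor `v_υ`:
  `‖E^{(K+n)}_ℂ(T) − E^{(K)}_ℂ(T)‖ ≤ (Γ′ + Γ·(C₂·L^{−γK}·nlines T + vsum (υ ↦ Θ_K + extRate (C₃·L^{−γK}) X_υ + s_υ) T))·(C₁^{nlines T}·vprod (υ ↦ extSize a c_e X_υ·q_υ) T)`,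
  `Θ_K = kingDressTheta` = RHS (3.72): each internal line `C₂·L^{−γK}` ((3.70)∕(3.73)), each vertex `Θ_K` ((3.72) — WHAT THE CURVED CASE ADDS, first order in `η`),
  each external line `C₃·L^{−γK}` (Prop. 3.8 «gives the desired factor L^{−γk}»), Props. 3.7∕3.8∕3.9 and (3.72) ALL BY NAME (Ω₂, Η-e, Κ-b).
HONEST SCOPE.  (a) As parts Ι-a–Ι-d: TREE graphs, `G`∕`∂G` lines, no loops∕orderings∕§3.5; (3.56)'s tree decay between external points not displayed (the external
lines' `exp[−δ₀|x − y_b|]` and sizes' decay are dropped to constants).  (b) Dressings of a CONSTANT field as printed (p. 661).  (c) King's U(1)∕`A = 0` model,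
cubes `2L^m`, odd `L ≥ 3`, constants per `(a, m₀², L)` at `α = ½`; NOT Bałaban's `G(U)`; counts unmoved.  Locators: [King1986] Prop. 3.6 (3.56) p.662, (3.46)
p.661, Prop. 3.8 (3.71) p.664, (3.72) p.665, pp.664–665.
-/

noncomputable section

namespace Summit.QuantumFields.YangMills.BalabanUVNodes.N15KingModelRung.Graph

open scoped BigOperators
open Finset

namespace STree

variable {ι υ : Type*}

/-- the number of vertices (= the number of `vtx` nodes of the encoding). [cite: King1986, (3.55)–(3.56) p.662] -/
def nverts : STree ι υ → ℕ
  | vtx _ => 1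
  | line _ t r => nverts t + nverts r

/-- a tree has a vertex: its label sort is inhabited. [folklore] -/
theorem nonempty_label : STree ι υ → Nonempty υ
  | vtx υ₀ => ⟨υ₀⟩
  | line _ t _ => nonempty_label t

/-- `vsum` of a constant is `nverts` times it. [folklore] -/
theorem vsum_const (c : ℝ) : ∀ T : STree ι υ, vsum (fun _ => c) T = c * nverts T
  | vtx _ => by simp [vsum, nverts]
  | line _ t r => by
      simp only [vsum, nverts, vsum_const c t, vsum_const c r, Nat.cast_add]
      ring

/-- `vsum` is additive in the functional. [folklore] -/
theorem vsum_add (s t : υ → ℝ) : ∀ T : STree ι υ, vsum (fun υ₀ => s υ₀ + t υ₀) T = vsum s T + vsum t T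
  | vtx _ => by simp [vsum]
  | line _ a b => by
      simp only [vsum, vsum_add s t a, vsum_add s t b]
      ring

end STree

/-! ## §1 A product of one-vertex factors -/

/-- ★ **A PRODUCT OF TWO ONE-VERTEX FACTORS**: if `‖f‖, ‖f′‖ ≤ p`, `‖g‖, ‖g′‖ ≤ q`, `‖f′(x′) − f(x)‖ ≤ s·p`, `‖g′(x′) − g(x)‖ ≤ t·q` (`x = pt x′`), then the product
has size `p·q` on both lattices and rate `‖f′g′(x′) − fg(x)‖ ≤ (s + t)·(p·q)` — relative rates ADD (`f′g′ − fg = (f′ − f)g′ + f(g′ − g)`).  How a vertex carrying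
several factors (source × dressing × external line) is ONE one-vertex factor of the engine. [cite: King1986, p.664 («replacing one by one every factor»)] -/
theorem oneVertex_mul {𝕜 : Type*} [RCLike 𝕜] {S S' : Type*} (pt : S' → S) (f : S → 𝕜) (f' : S' → 𝕜) (g : S → 𝕜) (g' : S' → 𝕜)
    {p q s t : ℝ} (hp0 : 0 ≤ p) (hf : ∀ x, ‖f x‖ ≤ p) (hf' : ∀ x', ‖f' x'‖ ≤ p) (hg : ∀ x, ‖g x‖ ≤ q) (hg' : ∀ x', ‖g' x'‖ ≤ q)
    (hs : ∀ x', ‖f' x' - f (pt x')‖ ≤ s * p) (ht : ∀ x', ‖g' x' - g (pt x')‖ ≤ t * q) :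
    (∀ x, ‖f x * g x‖ ≤ p * q) ∧ (∀ x', ‖f' x' * g' x'‖ ≤ p * q) ∧
    (∀ x', ‖f' x' * g' x' - f (pt x') * g (pt x')‖ ≤ (s + t) * (p * q)) := by
  have hq0 : ∀ x', 0 ≤ q := fun x' => (norm_nonneg _).trans (hg' x')
  refine ⟨fun x => ?_, fun x' => ?_, fun x' => ?_⟩
  · rw [norm_mul]; exact mul_le_mul (hf x) (hg x) (norm_nonneg _) hp0
  · rw [norm_mul]; exact mul_le_mul (hf' x') (hg' x') (norm_nonneg _) hp0
  · have hid : f' x' * g' x' - f (pt x') * g (pt x') = (f' x' - f (pt x')) * g' x' + f (pt x') * (g' x' - g (pt x')) := by ring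
    rw [hid]
    calc ‖(f' x' - f (pt x')) * g' x' + f (pt x') * (g' x' - g (pt x'))‖
        ≤ ‖f' x' - f (pt x')‖ * ‖g' x'‖ + ‖f (pt x')‖ * ‖g' x' - g (pt x')‖ := by
          refine (norm_add_le _ _).trans ?_; rw [norm_mul, norm_mul]
      _ ≤ (s * p) * q + p * (t * q) :=
          add_le_add (mul_le_mul (hs x') (hg' x') (norm_nonneg _) ((norm_nonneg _).trans (hs x')))
            (mul_le_mul (hf _) (ht x') (norm_nonneg _) hp0)
      _ = (s + t) * (p * q) := by ring

end Summit.QuantumFields.YangMills.BalabanUVNodes.N15KingModelRung.Graph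

namespace Summit.QuantumFields.YangMills.BalabanUVNodes.N15KingModelRung.Curved

open scoped BigOperators
open Finset
open Literature.MathematicalPhysics.QuantumFieldTheory.Balaban1983to89.B5Prop11Plancherel (Tor fine)
open Literature.MathematicalPhysics.QuantumFieldTheory.Balaban1983to89.B2 (pFn)
open Literature.MathematicalPhysics.QuantumFieldTheory.King1986.Torus (tdistT tdistT_nonneg)
open Literature.MathematicalPhysics.QuantumFieldTheory.King1986.SlicePropagator (Prop37PrintedAt Prop39PrintedAt)
open Summit.QuantumFields.YangMills.BalabanUVNodes.N15KingModelRung (KingVolIndex kingVol kingVol_neZero)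
open Summit.QuantumFields.YangMills.BalabanUVNodes.N15KingModelRung.Graph
open Summit.QuantumFields.YangMills.BalabanUVNodes.N15KingModelRung.Graph.STree

variable {d : ℕ} (L : ℕ) [NeZero L]

/-! ## §2 Proposition 3.6 for tree graphs with `𝕜`-valued one-vertex factors, constants explicit -/

section OfConstants

/-- ★★ **THE ASSEMBLY WITH EXPLICIT CONSTANTS** (over `RCLike 𝕜`): GIVEN Proposition 3.7 for the coarse and the fine run's slices (`Prop37PrintedAt α … C δ₀`) and
Proposition 3.9 on the two-spacing record at a rate `γ ≤ ½` — exactly the letters part Ω₂ `king_props37_38_39_commonConstants` supplies — for ONE mass,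
volume∕scales `j`, `n ≥ 1`: for every tree `T`, kinds `κ` (King's real full `A = 0` line kernels `kingGLine`, cast to `𝕜`), `𝕜`-valued one-vertex factors
(sizes `q_υ ≥ 0`, relative rates `s_υ ≥ 0`) and root sources (`Σ η^{d+1}‖g‖ ≤ Γ`, `Σ η′^{d+1}‖g′ − g∘pt‖ ≤ Γ′`):
`‖E^{(K+n)}(T) − E^{(K)}(T)‖ ≤ (Γ′ + Γ·(C₂·L^{−γK}·nlines T + vsum s T))·(C₁^{nlines T}·vprod q T)` with `C₁ = 2·C·c368`, `C₂ = ((1 − L^{−1∕2})^{−1} + 2)∕2` —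
part Ι-d's line-sum letters (`‖(r : 𝕜)‖ = |r|`) on the engine Ι-b `norm_treeAmp_sub_le_ratio` with the pairing's fibres (Η-c). [cite: King1986, Prop. 3.6 (3.56) p.662, pp.663–665] -/
theorem king_prop36_tree_of_constants (𝕜 : Type) [RCLike 𝕜] (hL : 2 ≤ L) {a : ℝ} (ha : 0 < a) (j : KingVolIndex d) {n : ℕ} (hn : 1 ≤ n)
    {msq : ℝ} (hm : 0 < msq) {α C δ₀ γ : ℝ} (hC : 0 < C) (hδ₀ : 0 < δ₀) (hγ : γ ≤ 1 / 2)
    (h37 : haveI := kingVol_neZero L j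
      Prop37PrintedAt α (kingSliceKernels L j.K j.m (kingVol L j) (fun _ => rfl) j.one_le_K a msq) C δ₀)
    (h37' : haveI := kingVol_neZero L j
      Prop37PrintedAt α (kingSliceKernels L (j.K + n) j.m (kingVol L j) (fun _ => rfl) (one_le_add_of_one_le j.one_le_K n) a msq) C δ₀)
    (h39 : haveI := kingVol_neZero L j
      Prop39PrintedAt α (kingSlicesTwoSpacing L j.K n j.m (kingVol L j) (fun _ => rfl) j.one_le_K a msq) C δ₀ γ)
    (ι υ : Type) (T : STree ι υ) (κ : ι → Option (Fin (d + 1)))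
    (u : haveI := kingVol_neZero L j; υ → Tor (fine (L ^ j.K) (kingVol L j)) → 𝕜)
    (u' : haveI := kingVol_neZero L j; υ → Tor (fine (L ^ (j.K + n)) (kingVol L j)) → 𝕜) (q s : υ → ℝ)
    (g : haveI := kingVol_neZero L j; Tor (fine (L ^ j.K) (kingVol L j)) → 𝕜)
    (g' : haveI := kingVol_neZero L j; Tor (fine (L ^ (j.K + n)) (kingVol L j)) → 𝕜) (Γ Γ' : ℝ)
    (hq : ∀ υ₀, 0 ≤ q υ₀) (hs : ∀ υ₀, 0 ≤ s υ₀) (hu : ∀ υ₀ x, ‖u υ₀ x‖ ≤ q υ₀) (hu' : ∀ υ₀ x', ‖u' υ₀ x'‖ ≤ q υ₀)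
    (hϑ : haveI := kingVol_neZero L j; ∀ υ₀ x', ‖u' υ₀ x' - u υ₀ (kingSlicePt L j.K n (kingVol L j) x')‖ ≤ s υ₀ * q υ₀)
    (hg : haveI := kingVol_neZero L j; ∑ x, (((L : ℝ) ^ j.K)⁻¹) ^ (d + 1) * ‖g x‖ ≤ Γ)
    (hg' : haveI := kingVol_neZero L j; ∑ x', (((L : ℝ) ^ (j.K + n))⁻¹) ^ (d + 1) * ‖g' x' - g (kingSlicePt L j.K n (kingVol L j) x')‖ ≤ Γ') :
    haveI := kingVol_neZero L j
    ‖treeAmp (((((L : ℝ) ^ (j.K + n))⁻¹) ^ (d + 1) : ℝ) : 𝕜) (fun ℓ x' y' => (kingGLine L (kingVol L j) a msq (j.K + n) (κ ℓ) x' y' : 𝕜)) u' g' T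
        - treeAmp (((((L : ℝ) ^ j.K)⁻¹) ^ (d + 1) : ℝ) : 𝕜) (fun ℓ x y => (kingGLine L (kingVol L j) a msq j.K (κ ℓ) x y : 𝕜)) u g T‖
      ≤ (Γ' + Γ * (((1 - (L : ℝ) ^ (-(1 / 2 : ℝ)))⁻¹ + 2) / 2 * (L : ℝ) ^ (-(γ * j.K)) * nlines T + vsum s T))
          * ((2 * C * c368 d δ₀) ^ nlines T * vprod q T) := by
  haveI := kingVol_neZero L j
  have hL0 : (0 : ℝ) < L := by exact_mod_cast (show 0 < L by omega)
  have hc368 := c368_pos d hδ₀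
  have hg0 : 0 < (1 - (L : ℝ) ^ (-(1 / 2 : ℝ)))⁻¹ := by
    obtain ⟨-, hx1, -⟩ := sliceBase_lt_one hL (by norm_num : (0 : ℝ) < 1 / 2)
    exact inv_pos.2 (by linarith)
  have hwK : (0 : ℝ) ≤ (((L : ℝ) ^ j.K)⁻¹) ^ (d + 1) := by positivity
  have hwKn : (0 : ℝ) ≤ (((L : ℝ) ^ (j.K + n))⁻¹) ^ (d + 1) := by positivity
  have hnK : ‖((((((L : ℝ) ^ j.K)⁻¹) ^ (d + 1) : ℝ) : 𝕜))‖ = (((L : ℝ) ^ j.K)⁻¹) ^ (d + 1) := by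
    rw [RCLike.norm_ofReal, abs_of_nonneg hwK]
  have hnKn : ‖((((((L : ℝ) ^ (j.K + n))⁻¹) ^ (d + 1) : ℝ) : 𝕜))‖ = (((L : ℝ) ^ (j.K + n))⁻¹) ^ (d + 1) := by
    rw [RCLike.norm_ofReal, abs_of_nonneg hwKn]
  have hfib := card_filter_kingSlicePt L j.K n (kingVol L j)
  have hw := king_weight_repair (d := d) L hL0 j.K n
  have hw' : (((L ^ n) ^ (d + 1) : ℕ) : 𝕜) * ((((((L : ℝ) ^ (j.K + n))⁻¹) ^ (d + 1) : ℝ) : 𝕜))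
      = ((((((L : ℝ) ^ j.K)⁻¹) ^ (d + 1) : ℝ) : 𝕜)) := by
    rw [← hw]; push_cast; ring
  -- the engine's hypotheses from part Ι-d's letters, cast to `𝕜`
  have hP : ∀ (ℓ : ι) (x : Tor (fine (L ^ j.K) (kingVol L j))),
      ∑ y, ‖((((((L : ℝ) ^ j.K)⁻¹) ^ (d + 1) : ℝ) : 𝕜))‖ * ‖(kingGLine L (kingVol L j) a msq j.K (κ ℓ) x y : 𝕜)‖ ≤ 2 * C * c368 d δ₀ := fun ℓ x => by
    simpa only [hnK, RCLike.norm_ofReal] using lineSum_kingGLine_le L hL ha j.one_le_K (kingVol L j) (fun _ => rfl) hm hC.le hδ₀ h37 (κ ℓ) x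
  have hP' : ∀ (ℓ : ι) (x' : Tor (fine (L ^ (j.K + n)) (kingVol L j))),
      ∑ y', ‖((((((L : ℝ) ^ (j.K + n))⁻¹) ^ (d + 1) : ℝ) : 𝕜))‖ * ‖(kingGLine L (kingVol L j) a msq (j.K + n) (κ ℓ) x' y' : 𝕜)‖
        ≤ 2 * C * c368 d δ₀ := fun ℓ x' => by
    simpa only [hnKn, RCLike.norm_ofReal] using
      lineSum_kingGLine_le L hL ha (one_le_add_of_one_le j.one_le_K n) (kingVol L j) (fun _ => rfl) hm hC.le hδ₀ h37' (κ ℓ) x'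
  have hρ : ∀ (ℓ : ι) (x' : Tor (fine (L ^ (j.K + n)) (kingVol L j))),
      ∑ y', ‖((((((L : ℝ) ^ (j.K + n))⁻¹) ^ (d + 1) : ℝ) : 𝕜))‖
          * ‖(kingGLine L (kingVol L j) a msq (j.K + n) (κ ℓ) x' y' : 𝕜)
              - (kingGLine L (kingVol L j) a msq j.K (κ ℓ) (kingSlicePt L j.K n (kingVol L j) x') (kingSlicePt L j.K n (kingVol L j) y') : 𝕜)‖
        ≤ (((1 - (L : ℝ) ^ (-(1 / 2 : ℝ)))⁻¹ + 2) / 2 * (L : ℝ) ^ (-(γ * j.K))) * (2 * C * c368 d δ₀) := fun ℓ x' => by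
    have h := lineRate_kingGLine_le L hL ha j.one_le_K hn (kingVol L j) (fun _ => rfl) hm hC.le hδ₀ hγ h37' h39 (κ ℓ) x'
    simp only [hnKn, ← RCLike.ofReal_sub, RCLike.norm_ofReal]
    refine h.trans (le_of_eq ?_)
    ring
  have hgn : ∑ x, ‖((((((L : ℝ) ^ j.K)⁻¹) ^ (d + 1) : ℝ) : 𝕜))‖ * ‖g x‖ ≤ Γ := by simpa only [hnK] using hg
  have hgn' : ∑ x', ‖((((((L : ℝ) ^ (j.K + n))⁻¹) ^ (d + 1) : ℝ) : 𝕜))‖ * ‖g' x' - g (kingSlicePt L j.K n (kingVol L j) x')‖ ≤ Γ' := by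
    simpa only [hnKn] using hg'
  have h := norm_treeAmp_sub_le_ratio (𝕜 := 𝕜) (kingSlicePt L j.K n (kingVol L j)) hfib hw'
    (fun ℓ x y => (kingGLine L (kingVol L j) a msq j.K (κ ℓ) x y : 𝕜))
    (fun ℓ x' y' => (kingGLine L (kingVol L j) a msq (j.K + n) (κ ℓ) x' y' : 𝕜)) u u' g g'
    (fun _ => 2 * C * c368 d δ₀) (fun _ => ((1 - (L : ℝ) ^ (-(1 / 2 : ℝ)))⁻¹ + 2) / 2 * (L : ℝ) ^ (-(γ * j.K))) q s
    (fun _ => by positivity) (fun _ => by positivity) hq hs hP hP' hρ hu hu' hϑ hgn hgn' T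
  rw [treeBound_const, lsum_const] at h
  refine h.trans (le_of_eq ?_)
  ring

/-- ★★ **PART Ι-d's THEOREM OVER `RCLike 𝕜`** (one-vertex factors and root sources `𝕜`-valued; the constants `(C₁, C₂, γ)` per `(a, m₀², L)` from part Ω₂ at
`α = ½`, `γ := min(γ_Ω₂, ½)`): `‖E^{(K+n)}(T) − E^{(K)}(T)‖ ≤ (Γ′ + Γ·(C₂·L^{−γK}·nlines T + vsum s T))·(C₁^{nlines T}·vprod q T)` uniformly in the mass window, the
volume, `K`, `n ≥ 1` and the tree.  (Part Ι-d's `king_prop36_tree_zeroField` is the `𝕜 = ℝ` reading without casts.) [cite: King1986, Prop. 3.6 (3.56) p.662, pp.663–665] -/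
theorem king_prop36_tree_zeroField_rclike (𝕜 : Type) [RCLike 𝕜] (hLodd : Odd L) (hL : 2 ≤ L) {a : ℝ} (ha : 0 < a) {m0sq : ℝ} (hm0 : 0 ≤ m0sq) :
    ∃ C₁ C₂ γ : ℝ, 0 < C₁ ∧ 0 < C₂ ∧ 0 < γ ∧ ∀ (msq : ℝ), 0 < msq → msq ≤ m0sq → ∀ (j : KingVolIndex d) (n : ℕ), 1 ≤ n →
      ∀ (ι υ : Type) (T : STree ι υ) (κ : ι → Option (Fin (d + 1))),
        haveI := kingVol_neZero L j
        ∀ (u : υ → Tor (fine (L ^ j.K) (kingVol L j)) → 𝕜) (u' : υ → Tor (fine (L ^ (j.K + n)) (kingVol L j)) → 𝕜) (q s : υ → ℝ)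
          (g : Tor (fine (L ^ j.K) (kingVol L j)) → 𝕜) (g' : Tor (fine (L ^ (j.K + n)) (kingVol L j)) → 𝕜) (Γ Γ' : ℝ),
          (∀ υ₀, 0 ≤ q υ₀) → (∀ υ₀, 0 ≤ s υ₀) → (∀ υ₀ x, ‖u υ₀ x‖ ≤ q υ₀) → (∀ υ₀ x', ‖u' υ₀ x'‖ ≤ q υ₀) →
          (∀ υ₀ x', ‖u' υ₀ x' - u υ₀ (kingSlicePt L j.K n (kingVol L j) x')‖ ≤ s υ₀ * q υ₀) →
          (∑ x, (((L : ℝ) ^ j.K)⁻¹) ^ (d + 1) * ‖g x‖ ≤ Γ) →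
          (∑ x', (((L : ℝ) ^ (j.K + n))⁻¹) ^ (d + 1) * ‖g' x' - g (kingSlicePt L j.K n (kingVol L j) x')‖ ≤ Γ') →
          ‖treeAmp (((((L : ℝ) ^ (j.K + n))⁻¹) ^ (d + 1) : ℝ) : 𝕜) (fun ℓ x' y' => (kingGLine L (kingVol L j) a msq (j.K + n) (κ ℓ) x' y' : 𝕜)) u' g' T
              - treeAmp (((((L : ℝ) ^ j.K)⁻¹) ^ (d + 1) : ℝ) : 𝕜) (fun ℓ x y => (kingGLine L (kingVol L j) a msq j.K (κ ℓ) x y : 𝕜)) u g T‖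
            ≤ (Γ' + Γ * (C₂ * (L : ℝ) ^ (-(γ * j.K)) * nlines T + vsum s T)) * (C₁ ^ nlines T * vprod q T) := by
  obtain ⟨C, δ₀, γ₀, hC, hδ₀, hγ₀, H⟩ := king_props37_38_39_commonConstants (d := d) L hLodd hL ha hm0 (α := 1 / 2) (by norm_num) (by norm_num)
  have hL1 : 1 ≤ L := by omega
  have hg0 : 0 < (1 - (L : ℝ) ^ (-(1 / 2 : ℝ)))⁻¹ := by
    obtain ⟨-, hx1, -⟩ := sliceBase_lt_one hL (by norm_num : (0 : ℝ) < 1 / 2)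
    exact inv_pos.2 (by linarith)
  have hc368 := c368_pos d hδ₀
  refine ⟨2 * C * c368 d δ₀, ((1 - (L : ℝ) ^ (-(1 / 2 : ℝ)))⁻¹ + 2) / 2, min γ₀ (1 / 2), by positivity, by positivity,
    lt_min hγ₀ (by norm_num), fun msq hm hcap j n hn ι υ T κ u u' q s g g' Γ Γ' hq hs hu hu' hϑ hg hg' => ?_⟩
  haveI := kingVol_neZero L j
  obtain ⟨h37, h37', -, h39⟩ := H msq hm hcap j n hn
  have h39m : Prop39PrintedAt (1 / 2) (kingSlicesTwoSpacing L j.K n j.m (kingVol L j) (fun _ => rfl) j.one_le_K a msq) C δ₀ (min γ₀ (1 / 2)) :=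
    prop39PrintedAt_mono (T := kingTwoSpacingFull L a msq j n) hL1 (kingTwoSpacingFull_lodist_nonneg L a msq j n) (fun _ _ b => nomatch b)
      hC.le le_rfl le_rfl (min_le_left _ _) h39
  exact king_prop36_tree_of_constants L 𝕜 hL ha j hn hm hC hδ₀ (min_le_right _ _) h37 h37' h39m ι υ T κ u u' q s g g' Γ Γ' hq hs hu hu' hϑ hg hg'

end OfConstants

/-! ## §3 The one-vertex factors of King's §3.3 BY NAME on every vertex: dressing (3.46) × external line (3.71) × abstract factor -/

section Full

/-- **THE EXTERNAL-LINE FACTOR AT A VERTEX** (coarse lattice): `1` when the vertex carries no external line (`none`), else `ℋ_K(x, y_b)` or `∂^η_μℋ_K(x, y_b)`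
(part Η-e `kingExtLo`, the unit point `y_b = basePt b`), read in `ℂ`. [cite: King1986, Prop. 3.8 (3.71) p.664] -/
def kingExtFac (a msq : ℝ) (j : KingVolIndex d) :
    Option (Tor (kingVol L j) × Option (Fin (d + 1))) → Tor (fine (L ^ j.K) (kingVol L j)) → ℂ
  | none => fun _ => 1
  | some bk => fun x => (kingExtLo L a msq j bk.1 bk.2 x : ℂ)

/-- the same on the fine lattice (part Η-e `kingExtHi`: `ℋ_{K+n}(x′, y_b)` ∕ `∂^{η′}_μℋ_{K+n}`). [cite: King1986, Prop. 3.8 (3.71) p.664] -/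
def kingExtFac' (a msq : ℝ) (j : KingVolIndex d) (n : ℕ) :
    Option (Tor (kingVol L j) × Option (Fin (d + 1))) → Tor (fine (L ^ (j.K + n)) (kingVol L j)) → ℂ
  | none => fun _ => 1
  | some bk => fun x' => (kingExtHi L a msq j n bk.1 bk.2 x' : ℂ)

omit [NeZero L] in
/-- the external-line factor's size letter: `1` or `a·c_e` (part Η-e `kingExt_sizes_unif`). [cite: King1986, Prop. 3.8 p.664] -/
def extSize {β : Type*} (a ce : ℝ) : Option β → ℝ
  | none => 1
  | some _ => a * ce

omit [NeZero L] in
/-- the external-line factor's relative-rate letter: `0` or `r` (`r = (C∕(a·c_e))·L^{−γK}` below). [cite: King1986, Prop. 3.8 (3.71) p.664] -/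
def extRate {β : Type*} (r : ℝ) : Option β → ℝ
  | none => 0
  | some _ => r

/-- ★★★ **KING 1986 PROPOSITION 3.6 (3.56) FOR TREE GRAPHS WITH THE ONE-VERTEX FACTORS OF §3.3 BY NAME** (`𝕜 = ℂ`, `A = 0`, constant background `B`).  For odd
`L ≥ 3`, `a > 0`, `m₀² ≥ 0` there are `C₁, C₂, C₃, c_e, γ > 0` such that for every `0 < m² ≤ m₀²`, `j` (`K = j.K ≥ 1`, torus `2L^{j.m}`), `n ≥ 1`, EVERY tree `T`,
kinds `κ` (lines: `G^η_K`∕`∂^η_μG^η_K`), and on every vertex `υ` the product of — the DRESSING (3.46) `exp[i·e·(L^kε)^{2−(d+1)/2}(h_υ(y) + B(Γ^{(K)}_{y,x}))]`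
(part Κ-b `kingDressing`; finer contour on `T_{η′}`), an optional EXTERNAL LINE `X_υ ∈ {none, (b, κ′)}` (`ℋ_K(x, y_b)`∕`∂ℋ_K`, part Η-e; `ℋ_{K+n}` on `T_{η′}`), and
an abstract complex factor `v_υ` (size `q_υ ≥ 0`, relative rate `s_υ ≥ 0`) — root sources `g, g′` (`Σ η^{d+1}‖g‖ ≤ Γ`, `Σ η′^{d+1}‖g′ − g∘pt‖ ≤ Γ′`), for every
`e ≥ 0`, `μ₀ > 0`, `0 < L^kε ≤ 1`, `b₀, p ≥ 0`, constant `|B_μ| ≤ p(L^{k−1}ε)/(μ₀L^{k−1}ε)` ((3.2)₁):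
`‖E^{(K+n)}_ℂ(T) − E^{(K)}_ℂ(T)‖ ≤ (Γ′ + Γ·(C₂·L^{−γK}·nlines T + vsum (υ ↦ Θ_K + extRate (C₃·L^{−γK}) X_υ + s_υ) T))·(C₁^{nlines T}·vprod (υ ↦ extSize a c_e X_υ · q_υ) T)`,
`Θ_K = kingDressTheta L K e μ₀ (L^kε) b₀ p` = RHS (3.72).  READING (`vsum_add`, `vsum_const`): each internal line `C₂·L^{−γK}` ((3.70)∕(3.73)), each vertex `Θ_K` ((3.72)),
each external line `C₃·L^{−γK}` (Prop. 3.8 (3.71) — «gives the desired factor L^{−γk}»), each abstract factor its own `s_υ`.  ASSEMBLY: Ω₂ `king_props37_38_39_commonConstants`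
at `α = ½` (Props. 3.7 both runs, 3.8, 3.9; `γ := min(γ_Ω₂, ½)`), Η-e `kingExt_sizes_unif`∕`kingExt_rate_of_prop38`, Κ-b `norm_kingDressing`∕`ineq372Printed_king`,
§1 `oneVertex_mul` (twice), §2 `king_prop36_tree_of_constants`. [cite: King1986, Prop. 3.6 (3.56) p.662, pp.664–665, (3.46) p.661, Prop. 3.8 (3.71) p.664, (3.72)–(3.73) p.665] -/
theorem king_prop36_tree_full (hLodd : Odd L) (hL : 2 ≤ L) {a : ℝ} (ha : 0 < a) {m0sq : ℝ} (hm0 : 0 ≤ m0sq) :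
    ∃ C₁ C₂ C₃ ce γ : ℝ, 0 < C₁ ∧ 0 < C₂ ∧ 0 < C₃ ∧ 0 < ce ∧ 0 < γ ∧ ∀ (msq : ℝ), 0 < msq → msq ≤ m0sq → ∀ (j : KingVolIndex d) (n : ℕ), 1 ≤ n →
      ∀ (ι υ : Type) (T : STree ι υ) (κ : ι → Option (Fin (d + 1))) (X : υ → Option (Tor (kingVol L j) × Option (Fin (d + 1)))),
        haveI := kingVol_neZero L j
        ∀ (v : υ → Tor (fine (L ^ j.K) (kingVol L j)) → ℂ) (v' : υ → Tor (fine (L ^ (j.K + n)) (kingVol L j)) → ℂ) (q s : υ → ℝ)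
          (g : Tor (fine (L ^ j.K) (kingVol L j)) → ℂ) (g' : Tor (fine (L ^ (j.K + n)) (kingVol L j)) → ℂ) (Γ Γ' : ℝ)
          (h : υ → Tor (kingVol L j) → ℝ) (e μ₀ Lkε b₀ p : ℝ) (B : Fin (d + 1) → ℝ),
          (∀ υ₀, 0 ≤ q υ₀) → (∀ υ₀, 0 ≤ s υ₀) → (∀ υ₀ x, ‖v υ₀ x‖ ≤ q υ₀) → (∀ υ₀ x', ‖v' υ₀ x'‖ ≤ q υ₀) →
          (∀ υ₀ x', ‖v' υ₀ x' - v υ₀ (kingSlicePt L j.K n (kingVol L j) x')‖ ≤ s υ₀ * q υ₀) →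
          (∑ x, (((L : ℝ) ^ j.K)⁻¹) ^ (d + 1) * ‖g x‖ ≤ Γ) →
          (∑ x', (((L : ℝ) ^ (j.K + n))⁻¹) ^ (d + 1) * ‖g' x' - g (kingSlicePt L j.K n (kingVol L j) x')‖ ≤ Γ') →
          0 ≤ e → 0 < μ₀ → 0 < Lkε → Lkε ≤ 1 → 0 ≤ b₀ → 0 ≤ p → (∀ μ, |B μ| ≤ pFn b₀ p (Lkε / L) * (μ₀ * (Lkε / L))⁻¹) →
          ‖treeAmp (((((L : ℝ) ^ (j.K + n))⁻¹) ^ (d + 1) : ℝ) : ℂ) (fun ℓ x' y' => (kingGLine L (kingVol L j) a msq (j.K + n) (κ ℓ) x' y' : ℂ))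
                (fun υ₀ x' => kingDressing L (j.K + n) (kingVol L j) e (Lkε ^ ((2 : ℝ) - ((d + 1 : ℕ) : ℝ) / 2)) (h υ₀) B x'
                  * kingExtFac' L a msq j n (X υ₀) x' * v' υ₀ x') g' T
              - treeAmp (((((L : ℝ) ^ j.K)⁻¹) ^ (d + 1) : ℝ) : ℂ) (fun ℓ x y => (kingGLine L (kingVol L j) a msq j.K (κ ℓ) x y : ℂ))
                (fun υ₀ x => kingDressing L j.K (kingVol L j) e (Lkε ^ ((2 : ℝ) - ((d + 1 : ℕ) : ℝ) / 2)) (h υ₀) B x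
                  * kingExtFac L a msq j (X υ₀) x * v υ₀ x) g T‖
            ≤ (Γ' + Γ * (C₂ * (L : ℝ) ^ (-(γ * j.K)) * nlines T
                  + vsum (fun υ₀ => kingDressTheta (d := d) L j.K e μ₀ Lkε b₀ p + extRate (C₃ * (L : ℝ) ^ (-(γ * j.K))) (X υ₀) + s υ₀) T))
                * (C₁ ^ nlines T * vprod (fun υ₀ => extSize a ce (X υ₀) * q υ₀) T) := by
  obtain ⟨C, δ₀, γ₀, hC, hδ₀, hγ₀, H⟩ := king_props37_38_39_commonConstants (d := d) L hLodd hL ha hm0 (α := 1 / 2) (by norm_num) (by norm_num)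
  obtain ⟨δe, ce, hδe, hce, He⟩ := kingExt_sizes_unif (d := d) (L := L) (a := a) hLodd hL ha hm0
  have hL1 : 1 ≤ L := by omega
  have hL1r : (1 : ℝ) ≤ L := by exact_mod_cast hL1
  have hg0 : 0 < (1 - (L : ℝ) ^ (-(1 / 2 : ℝ)))⁻¹ := by
    obtain ⟨-, hx1, -⟩ := sliceBase_lt_one hL (by norm_num : (0 : ℝ) < 1 / 2)
    exact inv_pos.2 (by linarith)
  have hc368 := c368_pos d hδ₀
  have hace : 0 < a * ce := mul_pos ha hce
  refine ⟨2 * C * c368 d δ₀, ((1 - (L : ℝ) ^ (-(1 / 2 : ℝ)))⁻¹ + 2) / 2, C / (a * ce), ce, min γ₀ (1 / 2), by positivity, by positivity,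
    div_pos hC hace, hce, lt_min hγ₀ (by norm_num),
    fun msq hm hcap j n hn ι υ T κ X v v' q s g g' Γ Γ' h e μ₀ Lkε b₀ p B hq hs hv hv' hϑ hg hg' he hμ₀ hε hε1 hb hp hB => ?_⟩
  haveI := kingVol_neZero L j
  obtain ⟨h37, h37', h38, h39⟩ := H msq hm hcap j n hn
  have h39m : Prop39PrintedAt (1 / 2) (kingSlicesTwoSpacing L j.K n j.m (kingVol L j) (fun _ => rfl) j.one_le_K a msq) C δ₀ (min γ₀ (1 / 2)) :=
    prop39PrintedAt_mono (T := kingTwoSpacingFull L a msq j n) hL1 (kingTwoSpacingFull_lodist_nonneg L a msq j n) (fun _ _ b => nomatch b)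
      hC.le le_rfl le_rfl (min_le_left _ _) h39
  -- the rate `L^{−γ₀K} ≤ L^{−γK}` at the smaller `γ = min(γ₀, ½)`
  have hLγ : (L : ℝ) ^ (-(γ₀ * j.K)) ≤ (L : ℝ) ^ (-(min γ₀ (1 / 2) * j.K)) := by
    refine Real.rpow_le_rpow_of_exponent_le hL1r ?_
    have hK0 : (0 : ℝ) ≤ j.K := Nat.cast_nonneg _
    nlinarith [min_le_left γ₀ (1 / 2)]
  -- (1) the dressing: size 1, relative rate Θ_K ((3.72) by name)
  obtain ⟨υ₁⟩ := T.nonempty_label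
  have hΘ1 : ‖kingDressing L (j.K + n) (kingVol L j) e (Lkε ^ ((2 : ℝ) - ((d + 1 : ℕ) : ℝ) / 2)) (h υ₁) B 0
        - kingDressing L j.K (kingVol L j) e (Lkε ^ ((2 : ℝ) - ((d + 1 : ℕ) : ℝ) / 2)) (h υ₁) B (kingSlicePt L j.K n (kingVol L j) 0)‖
      ≤ kingDressTheta (d := d) L j.K e μ₀ Lkε b₀ p :=
    ineq372Printed_king L j.K n (kingVol L j) (h υ₁) he hμ₀ hε hε1 hb hp hL1 hB 0
  have hΘ0 : 0 ≤ kingDressTheta (d := d) L j.K e μ₀ Lkε b₀ p := (norm_nonneg _).trans hΘ1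
  -- (2) the external-line factor: size `extSize`, relative rate `extRate (C₃ L^{−γK})` (Prop. 3.8 by name)
  have hXsz : ∀ υ₀ x, ‖kingExtFac L a msq j (X υ₀) x‖ ≤ extSize a ce (X υ₀) := by
    intro υ₀ x
    rcases hX : X υ₀ with _ | ⟨b, κ'⟩
    · simp [kingExtFac, extSize]
    · simp only [kingExtFac, extSize, Complex.norm_real]
      refine ((He msq hm.le hcap j n b κ').1 x).trans ?_
      exact mul_le_of_le_one_right hace.le (Real.exp_le_one_iff.2 (by
        have := tdistT_nonneg (kingVol L j) (Literature.MathematicalPhysics.QuantumFieldTheory.King1986.Torus.blockOf (L ^ j.K) (kingVol L j) x) b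
        nlinarith))
  have hXsz' : ∀ υ₀ x', ‖kingExtFac' L a msq j n (X υ₀) x'‖ ≤ extSize a ce (X υ₀) := by
    intro υ₀ x'
    rcases hX : X υ₀ with _ | ⟨b, κ'⟩
    · simp [kingExtFac', extSize]
    · simp only [kingExtFac', extSize, Complex.norm_real]
      refine ((He msq hm.le hcap j n b κ').2 x').trans ?_
      exact mul_le_of_le_one_right hace.le (Real.exp_le_one_iff.2 (by
        have := tdistT_nonneg (kingVol L j)
          (Literature.MathematicalPhysics.QuantumFieldTheory.King1986.Torus.blockOf (L ^ j.K) (kingVol L j) (kingSlicePt L j.K n (kingVol L j) x')) b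
        nlinarith))
  have hXrt : ∀ υ₀ x', ‖kingExtFac' L a msq j n (X υ₀) x' - kingExtFac L a msq j (X υ₀) (kingSlicePt L j.K n (kingVol L j) x')‖
      ≤ extRate (C / (a * ce) * (L : ℝ) ^ (-(min γ₀ (1 / 2) * j.K))) (X υ₀) * extSize a ce (X υ₀) := by
    intro υ₀ x'
    rcases hX : X υ₀ with _ | ⟨b, κ'⟩
    · simp [kingExtFac, kingExtFac', extRate]
    · simp only [kingExtFac, kingExtFac', extRate, extSize, ← Complex.ofReal_sub, Complex.norm_real]
      have hr := kingExt_rate_of_prop38 (L := L) (a := a) (msq := msq) (j := j) h38 b κ' x'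
      refine hr.trans ?_
      have hexp : Real.exp (-(δ₀ * (tdistT (fine (L ^ j.K) (kingVol L j)) (kingSlicePt L j.K n (kingVol L j) x')
          (Summit.QuantumFields.YangMills.BalabanUVNodes.N15KingModelRung.basePt (L ^ j.K) (kingVol L j) b) / (L : ℝ) ^ j.K))) ≤ 1 :=
        Real.exp_le_one_iff.2 (by
          have := tdistT_nonneg (fine (L ^ j.K) (kingVol L j)) (kingSlicePt L j.K n (kingVol L j) x')
            (Summit.QuantumFields.YangMills.BalabanUVNodes.N15KingModelRung.basePt (L ^ j.K) (kingVol L j) b)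
          have : 0 ≤ tdistT (fine (L ^ j.K) (kingVol L j)) (kingSlicePt L j.K n (kingVol L j) x')
            (Summit.QuantumFields.YangMills.BalabanUVNodes.N15KingModelRung.basePt (L ^ j.K) (kingVol L j) b) / (L : ℝ) ^ j.K := by positivity
          nlinarith [hδ₀.le])
      calc C * (L : ℝ) ^ (-(γ₀ * j.K)) * Real.exp (-(δ₀ * (tdistT (fine (L ^ j.K) (kingVol L j)) (kingSlicePt L j.K n (kingVol L j) x')
              (Summit.QuantumFields.YangMills.BalabanUVNodes.N15KingModelRung.basePt (L ^ j.K) (kingVol L j) b) / (L : ℝ) ^ j.K)))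
          ≤ C * (L : ℝ) ^ (-(min γ₀ (1 / 2) * j.K)) * 1 :=
            mul_le_mul (mul_le_mul_of_nonneg_left hLγ hC.le) hexp (Real.exp_nonneg _) (by positivity)
        _ = C / (a * ce) * (L : ℝ) ^ (-(min γ₀ (1 / 2) * j.K)) * (a * ce) := by field_simp
  -- (3) the composite one-vertex factor `(U·X)·v`
  have hUX := fun υ₀ => oneVertex_mul (𝕜 := ℂ) (kingSlicePt L j.K n (kingVol L j))
    (fun x => kingDressing L j.K (kingVol L j) e (Lkε ^ ((2 : ℝ) - ((d + 1 : ℕ) : ℝ) / 2)) (h υ₀) B x)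
    (fun x' => kingDressing L (j.K + n) (kingVol L j) e (Lkε ^ ((2 : ℝ) - ((d + 1 : ℕ) : ℝ) / 2)) (h υ₀) B x')
    (kingExtFac L a msq j (X υ₀)) (kingExtFac' L a msq j n (X υ₀))
    (p := 1) (q := extSize a ce (X υ₀)) (s := kingDressTheta (d := d) L j.K e μ₀ Lkε b₀ p)
    (t := extRate (C / (a * ce) * (L : ℝ) ^ (-(min γ₀ (1 / 2) * j.K))) (X υ₀)) zero_le_one
    (fun x => (norm_kingDressing L j.K (kingVol L j) e _ (h υ₀) B x).le)
    (fun x' => (norm_kingDressing L (j.K + n) (kingVol L j) e _ (h υ₀) B x').le) (hXsz υ₀) (hXsz' υ₀)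
    (fun x' => by rw [mul_one]; exact ineq372Printed_king L j.K n (kingVol L j) (h υ₀) he hμ₀ hε hε1 hb hp hL1 hB x') (hXrt υ₀)
  have hX0 : ∀ υ₀, 0 ≤ extSize a ce (X υ₀) := fun υ₀ => by
    rcases X υ₀ with _ | _ <;> simp only [extSize] <;> positivity
  have hR0 : ∀ υ₀, 0 ≤ extRate (C / (a * ce) * (L : ℝ) ^ (-(min γ₀ (1 / 2) * j.K))) (X υ₀) := fun υ₀ => by
    rcases X υ₀ with _ | _ <;> simp only [extRate] <;> positivity
  have hUXv := fun υ₀ => oneVertex_mul (𝕜 := ℂ) (kingSlicePt L j.K n (kingVol L j))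
    (fun x => kingDressing L j.K (kingVol L j) e (Lkε ^ ((2 : ℝ) - ((d + 1 : ℕ) : ℝ) / 2)) (h υ₀) B x * kingExtFac L a msq j (X υ₀) x)
    (fun x' => kingDressing L (j.K + n) (kingVol L j) e (Lkε ^ ((2 : ℝ) - ((d + 1 : ℕ) : ℝ) / 2)) (h υ₀) B x' * kingExtFac' L a msq j n (X υ₀) x')
    (v υ₀) (v' υ₀) (p := extSize a ce (X υ₀)) (q := q υ₀)
    (s := kingDressTheta (d := d) L j.K e μ₀ Lkε b₀ p + extRate (C / (a * ce) * (L : ℝ) ^ (-(min γ₀ (1 / 2) * j.K))) (X υ₀)) (t := s υ₀) (hX0 υ₀)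
    (fun x => by simpa only [one_mul] using (hUX υ₀).1 x) (fun x' => by simpa only [one_mul] using (hUX υ₀).2.1 x')
    (hv υ₀) (hv' υ₀) (fun x' => by simpa only [one_mul] using (hUX υ₀).2.2 x') (hϑ υ₀)
  -- (4) §2 with the composite factors
  exact king_prop36_tree_of_constants L ℂ hL ha j hn hm hC hδ₀ (min_le_right _ _) h37 h37' h39m ι υ T κ
    (fun υ₀ x => kingDressing L j.K (kingVol L j) e (Lkε ^ ((2 : ℝ) - ((d + 1 : ℕ) : ℝ) / 2)) (h υ₀) B x * kingExtFac L a msq j (X υ₀) x * v υ₀ x)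
    (fun υ₀ x' => kingDressing L (j.K + n) (kingVol L j) e (Lkε ^ ((2 : ℝ) - ((d + 1 : ℕ) : ℝ) / 2)) (h υ₀) B x'
      * kingExtFac' L a msq j n (X υ₀) x' * v' υ₀ x')
    (fun υ₀ => extSize a ce (X υ₀) * q υ₀)
    (fun υ₀ => kingDressTheta (d := d) L j.K e μ₀ Lkε b₀ p + extRate (C / (a * ce) * (L : ℝ) ^ (-(min γ₀ (1 / 2) * j.K))) (X υ₀) + s υ₀)
    g g' Γ Γ' (fun υ₀ => mul_nonneg (hX0 υ₀) (hq υ₀)) (fun υ₀ => add_nonneg (add_nonneg hΘ0 (hR0 υ₀)) (hs υ₀))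
    (fun υ₀ x => (hUXv υ₀).1 x) (fun υ₀ x' => (hUXv υ₀).2.1 x') (fun υ₀ x' => (hUXv υ₀).2.2 x') hg hg'

end Full

end Summit.QuantumFields.YangMills.BalabanUVNodes.N15KingModelRung.Curved

end
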